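import Mathlib
import Summits.CriticalPhenomena.PercolationContinuityZ3.Theorems.PercNearOneGluingNoHeavyLowerTailFatMinorityAveragedGluing
import HarnessLib

/-!
# `NoHeavyLowerTail` (stmt-CriticalPhenomena-4575), line fat-minority-linear — the law and geometry of
# the RELAY-FREE POCKET, glued inside and killed on its boundary

Route task `nh-dp-fatminority` (gen 2).  For a general finite weighted graph (`Fin n`, `w`), a relay set
`A` and an observer `o ∉ A`, the relay-free pocket of a configuration is
`C* = {v | o ↔ v using only vertices outside A}` (`openConnIn (↑A)ᶜ o v`).  For a candidate value `W`
write `Pk_W = {ω | ∀ v, ω ∈ openConnIn (↑A)ᶜ o v ↔ v ∈ W}` and let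
`Ψ_W ω = {e | (e ∈ ω ∧ ¬(∀ x ∈ e, x ∈ W) ∧ ¬ Bdry_W e) ∨ ((∀ x ∈ e, x ∈ W) ∧ ¬ e.IsDiag)}`
(glue the pocket, delete its boundary pairs `Bdry_W e := (∃ x ∈ e, x ∈ W) ∧ (∃ y ∈ e, y ∉ W ∧ y ∉ A)`,
keep everything else), whose law is `prodBernoulli q_W`,
`q_W e = if (∀ x ∈ e, x ∈ W) ∧ ¬ e.IsDiag then 1 else if (∀ x ∈ e, x ∈ W) ∨ Bdry_W e then 0 else w e`.

* `pocket_null_of_not_subset` — candidate pockets leaving a closed `A`-free region `U ∋ o` are null;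
* `pocket_boundary_closed`, `pocket_mem_of_mem`, `pocket_determinedBy` — on `Pk_W` the boundary pairs
  are closed and `W ∋ o` avoids `A`; `Pk_W` is determined by the pairs inside `W` and the boundary pairs.
* `pocket_reachable_iff` — on `Pk_W`, `Ψ_W ω` and `ω` have the same connected pairs of vertices.
* `pocketLaw` — `μ(Pk_W ∩ Ψ_W⁻¹ E) = μ(Pk_W) · (prodBernoulli q_W)(E)` for every event `E` (domain Markov
  property of the pocket + coordinatewise push-forward, `sigmaLaw_prodBernoulli_map_coordwise`).
Under `q_W` the block `W` is star-attached to `A`, so `averagedBlockGluing` applies pocket by pocket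
(file `…FatMinorityCoherentPockets.lean`).  No new definitions (everything written out).
[folklore; Grimmett 1999 §1.3, §2.2; Kozma–Nitzan arXiv:2401.12397 §3.2]
-/

namespace Summit.CriticalPhenomena.PercolationContinuityZ3.Theorems

open MeasureTheory Set ProbabilityTheory
open Literature.Probability.LatticeModels (prodBernoulli prodBernoulli_real_inter_of_determinedBy)
open Literature.Probability.Percolation (BondConfig openConn openConnIn openGraph openGraph_adj PathIn
  DeterminedBy determinedBy_iff)
open scoped BigOperators

noncomputable section
open Classical

variable {n : ℕ}

/-! ## Geometry of the pocket event -/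

/-- On the pocket event, an open pair from the pocket to a vertex outside `W ∪ A` is impossible
(its outer end would belong to the pocket). [folklore] -/
theorem pocket_boundary_closed (A W : Finset (Fin n)) (o : Fin n) {ω : BondConfig (Fin n)}
    (hω : ∀ v : Fin n, ω ∈ openConnIn ((↑A : Set (Fin n))ᶜ) o v ↔ v ∈ W) {x y : Fin n}
    (hx : x ∈ W) (hy : y ∉ W) (hyA : y ∉ A) : s(x, y) ∉ ω := by
  intro hxy
  have hp : PathIn (openGraph ω) ((↑A : Set (Fin n))ᶜ) o x :=
    Literature.Probability.Percolation.DCT16.pathIn_of_mem_openConnIn ((hω x).2 hx)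
  have hne : x ≠ y := fun h => hy (h ▸ hx)
  have hpy := hp.tail ((openGraph_adj ω x y).2 ⟨hxy, hne⟩) (fun h => hyA (Finset.mem_coe.1 h))
  exact hy ((hω y).1 (Literature.Probability.Percolation.DCT16.mem_openConnIn_of_pathIn hpy))

/-- On the pocket event, `o ∈ W` and `W` avoids `A`. [folklore] -/
theorem pocket_mem_of_mem (A W : Finset (Fin n)) (o : Fin n) (hoA : o ∉ A) {ω : BondConfig (Fin n)}
    (hω : ∀ v : Fin n, ω ∈ openConnIn ((↑A : Set (Fin n))ᶜ) o v ↔ v ∈ W) :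
    o ∈ W ∧ ∀ v ∈ W, v ∉ A := by
  have hoAc : o ∈ ((↑A : Set (Fin n))ᶜ) := fun h => hoA (Finset.mem_coe.1 h)
  refine ⟨(hω o).1 ⟨hoAc, hoAc, SimpleGraph.Reachable.refl _⟩, fun v hv hvA => ?_⟩
  obtain ⟨-, hvc, -⟩ := (hω v).2 hv
  exact hvc (Finset.mem_coe.2 hvA)

/-- On the pocket event every vertex of `W` is joined to `o` INSIDE `W`. [folklore] -/
theorem pocket_openConnIn_of_mem (A W : Finset (Fin n)) (o : Fin n) {ω : BondConfig (Fin n)}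
    (hω : ∀ v : Fin n, ω ∈ openConnIn ((↑A : Set (Fin n))ᶜ) o v ↔ v ∈ W) {v : Fin n}
    (hv : v ∈ W) : ω ∈ openConnIn (↑W : Set (Fin n)) o v := by
  have hp : PathIn (openGraph ω) ((↑A : Set (Fin n))ᶜ) o v :=
    Literature.Probability.Percolation.DCT16.pathIn_of_mem_openConnIn ((hω v).2 hv)
  have hoW : o ∈ (↑W : Set (Fin n)) := Finset.mem_coe.2
    ((hω o).1 (Literature.Probability.Percolation.DCT16.mem_openConnIn_of_pathIn
      (PathIn.refl hp.left_mem)))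
  rcases hp.exit_or (R := (↑W : Set (Fin n))) hoW with h | ⟨x, y, -, hy, hyU, hxy, hpx⟩
  · exact Literature.Probability.Percolation.DCT16.mem_openConnIn_of_pathIn
      (h.mono Set.inter_subset_left)
  · exfalso
    have hpy : PathIn (openGraph ω) ((↑A : Set (Fin n))ᶜ) o y :=
      (hpx.mono Set.inter_subset_right).tail hxy hyU
    exact hy (Finset.mem_coe.2
      ((hω y).1 (Literature.Probability.Percolation.DCT16.mem_openConnIn_of_pathIn hpy)))

/-- **Transfer of the pocket event between configurations agreeing on the pairs inside `W` and on
the boundary pairs of `W`.** [folklore; Grimmett 1999 §2.2] -/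
theorem pocket_of_inter_eq (A W : Finset (Fin n)) (o : Fin n) (hoA : o ∉ A)
    {ω ω' : BondConfig (Fin n)}
    (h : ω ∩ (↑(Finset.univ.filter fun e : Sym2 (Fin n) =>
        (∀ x ∈ e, x ∈ W) ∨ ((∃ x ∈ e, x ∈ W) ∧ (∃ y ∈ e, y ∉ W ∧ y ∉ A))) : Set (Sym2 (Fin n))) =
      ω' ∩ (↑(Finset.univ.filter fun e : Sym2 (Fin n) =>
        (∀ x ∈ e, x ∈ W) ∨ ((∃ x ∈ e, x ∈ W) ∧ (∃ y ∈ e, y ∉ W ∧ y ∉ A))) : Set (Sym2 (Fin n))))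
    (hω : ∀ v : Fin n, ω ∈ openConnIn ((↑A : Set (Fin n))ᶜ) o v ↔ v ∈ W) :
    ∀ v : Fin n, ω' ∈ openConnIn ((↑A : Set (Fin n))ᶜ) o v ↔ v ∈ W := by
  set F : Set (Sym2 (Fin n)) := ↑(Finset.univ.filter fun e : Sym2 (Fin n) =>
      (∀ x ∈ e, x ∈ W) ∨ ((∃ x ∈ e, x ∈ W) ∧ (∃ y ∈ e, y ∉ W ∧ y ∉ A))) with hF
  have hmemF : ∀ e : Sym2 (Fin n), e ∈ F ↔
      ((∀ x ∈ e, x ∈ W) ∨ ((∃ x ∈ e, x ∈ W) ∧ (∃ y ∈ e, y ∉ W ∧ y ∉ A))) := by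
    intro e; simp [hF]
  have hagree : ∀ e ∈ F, (e ∈ ω ↔ e ∈ ω') := fun e he =>
    ⟨fun h1 => (((Set.ext_iff.1 h) e).1 ⟨h1, he⟩).1, fun h1 => (((Set.ext_iff.1 h) e).2 ⟨h1, he⟩).1⟩
  obtain ⟨hoW, hWA⟩ := pocket_mem_of_mem A W o hoA hω
  have hWsub : (↑W : Set (Fin n)) ⊆ ((↑A : Set (Fin n))ᶜ) := fun v hv hvA =>
    hWA v (Finset.mem_coe.1 hv) (Finset.mem_coe.1 hvA)
  intro v
  constructor
  · -- an open `ω'`-path from `o` avoiding `A` cannot leave `W` (boundary pairs agree and are closed)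
    intro hv
    have hp : PathIn (openGraph ω') ((↑A : Set (Fin n))ᶜ) o v :=
      Literature.Probability.Percolation.DCT16.pathIn_of_mem_openConnIn hv
    rcases hp.exit_or (R := (↑W : Set (Fin n))) (Finset.mem_coe.2 hoW) with h' | ⟨x, y, hx, hy, hyA, hxy, -⟩
    · exact Finset.mem_coe.1 h'.right_mem.1
    · exfalso
      rw [openGraph_adj] at hxy
      have hxW : x ∈ W := Finset.mem_coe.1 hx
      have hyW : y ∉ W := fun h' => hy (Finset.mem_coe.2 h')
      have hyA' : y ∉ A := fun h' => hyA (Finset.mem_coe.2 h')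
      have heF : s(x, y) ∈ F := (hmemF _).2 (Or.inr ⟨⟨x, Sym2.mem_mk_left x y, hxW⟩,
        ⟨y, Sym2.mem_mk_right x y, hyW, hyA'⟩⟩)
      exact pocket_boundary_closed A W o hω hxW hyW hyA' ((hagree _ heF).2 hxy.1)
  · -- a path inside `W` only uses pairs inside `W`, on which `ω` and `ω'` agree
    intro hv
    have h1 := pocket_openConnIn_of_mem A W o hω hv
    have hK : (↑W : Set (Fin n)).sym2 ⊆ F := by
      intro e he
      refine (hmemF e).2 (Or.inl fun x hx => ?_)
      induction e using Sym2.ind with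
      | h p q =>
        rw [Set.mk_mem_sym2_iff] at he
        rcases Sym2.mem_iff.1 hx with rfl | rfl
        · exact Finset.mem_coe.1 he.1
        · exact Finset.mem_coe.1 he.2
    have h2 : ω' ∈ openConnIn (↑W : Set (Fin n)) o v :=
      ((determinedBy_iff _ _).1
        (Literature.Probability.Percolation.DCT16.determinedBy_openConnIn (↑W : Set (Fin n)) o v hK)
        ω ω' h).1 h1
    exact Literature.Probability.Percolation.DCT16.mem_openConnIn_of_pathIn
      ((Literature.Probability.Percolation.DCT16.pathIn_of_mem_openConnIn h2).mono hWsub)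

/-- **The pocket event is determined by the pairs inside `W` and the boundary pairs of `W`.**
[folklore; Grimmett 1999 §2.2] -/
theorem pocket_determinedBy (A W : Finset (Fin n)) (o : Fin n) (hoA : o ∉ A) :
    DeterminedBy {ω : BondConfig (Fin n) | ∀ v : Fin n, ω ∈ openConnIn ((↑A : Set (Fin n))ᶜ) o v ↔ v ∈ W}
      (↑(Finset.univ.filter fun e : Sym2 (Fin n) =>
        (∀ x ∈ e, x ∈ W) ∨ ((∃ x ∈ e, x ∈ W) ∧ (∃ y ∈ e, y ∉ W ∧ y ∉ A))) : Set (Sym2 (Fin n))) := by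
  rw [determinedBy_iff]
  intro ω ω' h
  exact ⟨fun hω => pocket_of_inter_eq A W o hoA h hω, fun hω' => pocket_of_inter_eq A W o hoA h.symm hω'⟩

/-- **On the pocket event, gluing the pocket and deleting its (closed) boundary pairs does not change
which vertices are joined.** [folklore] -/
theorem pocket_reachable_iff (A W : Finset (Fin n)) (o : Fin n) {ω : BondConfig (Fin n)}
    (hω : ∀ v : Fin n, ω ∈ openConnIn ((↑A : Set (Fin n))ᶜ) o v ↔ v ∈ W) (u v : Fin n) :
    (openGraph ({e | (e ∈ ω ∧ ¬ (∀ x ∈ e, x ∈ W) ∧ ¬ ((∃ x ∈ e, x ∈ W) ∧ (∃ y ∈ e, y ∉ W ∧ y ∉ A))) ∨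
        ((∀ x ∈ e, x ∈ W) ∧ ¬ e.IsDiag)} : BondConfig (Fin n))).Reachable u v ↔
      (openGraph ω).Reachable u v := by
  set ξ : BondConfig (Fin n) := {e | (e ∈ ω ∧ ¬ (∀ x ∈ e, x ∈ W) ∧
      ¬ ((∃ x ∈ e, x ∈ W) ∧ (∃ y ∈ e, y ∉ W ∧ y ∉ A))) ∨ ((∀ x ∈ e, x ∈ W) ∧ ¬ e.IsDiag)} with hξ
  -- every vertex of `W` is joined to `o` in `ω`
  have hWo : ∀ x ∈ W, (openGraph ω).Reachable o x := fun x hx =>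
    Literature.Probability.Percolation.DCT16.reachable_of_pathIn
      (Literature.Probability.Percolation.DCT16.pathIn_of_mem_openConnIn
        (pocket_openConnIn_of_mem A W o hω hx))
  -- `ω ≤ ξ` as graphs
  have hle : openGraph ω ≤ openGraph ξ := by
    intro x y hxy
    rw [openGraph_adj] at hxy ⊢
    refine ⟨?_, hxy.2⟩
    by_cases hI : ∀ z ∈ s(x, y), z ∈ W
    · exact Or.inr ⟨hI, fun hd => hxy.2 (Sym2.mk_isDiag_iff.1 hd)⟩
    · refine Or.inl ⟨hxy.1, hI, ?_⟩
      rintro ⟨⟨p, hp, hpW⟩, ⟨q, hq, hqW, hqA⟩⟩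
      -- an open boundary pair: impossible on the pocket event
      have key : ∀ p q : Fin n, s(p, q) = s(x, y) → p ∈ W → q ∉ W → q ∉ A → False := by
        intro p q hpq hp' hq' hqA'
        exact pocket_boundary_closed A W o hω hp' hq' hqA' (hpq ▸ hxy.1)
      rcases Sym2.mem_iff.1 hp with rfl | rfl <;> rcases Sym2.mem_iff.1 hq with rfl | rfl
      · exact hqW hpW
      · exact key _ _ rfl hpW hqW hqA
      · exact key _ _ Sym2.eq_swap hpW hqW hqA
      · exact hqW hpW
  constructor
  · intro h
    -- replace every glued pair inside `W` by an `ω`-path through `o`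
    rw [SimpleGraph.reachable_iff_reflTransGen] at h ⊢
    induction h with
    | refl => exact Relation.ReflTransGen.refl
    | @tail p q _ hpq ih =>
      rw [openGraph_adj] at hpq
      obtain ⟨hmem, hne⟩ := hpq
      rcases hmem with ⟨hω', -, -⟩ | ⟨hI, -⟩
      · exact ih.tail ((openGraph_adj ω p q).2 ⟨hω', hne⟩)
      · have hp : p ∈ W := hI p (Sym2.mem_mk_left p q)
        have hq : q ∈ W := hI q (Sym2.mem_mk_right p q)
        have hr : (openGraph ω).Reachable p q := (hWo p hp).symm.trans (hWo q hq)
        rw [SimpleGraph.reachable_iff_reflTransGen] at hr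
        exact ih.trans hr
  · intro h
    exact h.mono hle

/-! ## The law of the glued pocket -/

/-- The one-coordinate computation behind `pocketLaw`. [folklore] -/
theorem pocketLaw_map_coin (w : Sym2 (Fin n) → unitInterval) (A W : Finset (Fin n)) (e : Sym2 (Fin n)) :
    (Ber(True, False, w e)).map
        (fun P : Prop => (P ∧ ¬ (∀ x ∈ e, x ∈ W) ∧ ¬ ((∃ x ∈ e, x ∈ W) ∧ (∃ y ∈ e, y ∉ W ∧ y ∉ A))) ∨
          ((∀ x ∈ e, x ∈ W) ∧ ¬ e.IsDiag)) =
      Ber(True, False, (if (∀ x ∈ e, x ∈ W) ∧ ¬ e.IsDiag then 1 else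
        if (∀ x ∈ e, x ∈ W) ∨ ((∃ x ∈ e, x ∈ W) ∧ (∃ y ∈ e, y ∉ W ∧ y ∉ A)) then 0 else w e)) := by
  rw [map_bernoulliMeasure]
  by_cases hS : (∀ x ∈ e, x ∈ W) ∧ ¬ e.IsDiag
  · have h1 : ((True ∧ ¬ (∀ x ∈ e, x ∈ W) ∧ ¬ ((∃ x ∈ e, x ∈ W) ∧ (∃ y ∈ e, y ∉ W ∧ y ∉ A))) ∨
        ((∀ x ∈ e, x ∈ W) ∧ ¬ e.IsDiag)) = True := propext (iff_true_intro (Or.inr hS))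
    have h2 : ((False ∧ ¬ (∀ x ∈ e, x ∈ W) ∧ ¬ ((∃ x ∈ e, x ∈ W) ∧ (∃ y ∈ e, y ∉ W ∧ y ∉ A))) ∨
        ((∀ x ∈ e, x ∈ W) ∧ ¬ e.IsDiag)) = True := propext (iff_true_intro (Or.inr hS))
    simp only [h1, h2, if_pos hS, bernoulliMeasure_self_eq_dirac, bernoulliMeasure_one]
  · by_cases hZ : (∀ x ∈ e, x ∈ W) ∨ ((∃ x ∈ e, x ∈ W) ∧ (∃ y ∈ e, y ∉ W ∧ y ∉ A))
    · have hnot : ¬ (¬ (∀ x ∈ e, x ∈ W) ∧ ¬ ((∃ x ∈ e, x ∈ W) ∧ (∃ y ∈ e, y ∉ W ∧ y ∉ A))) := by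
        rintro ⟨h1, h2⟩
        rcases hZ with h | h
        · exact h1 h
        · exact h2 h
      have h1 : ((True ∧ ¬ (∀ x ∈ e, x ∈ W) ∧ ¬ ((∃ x ∈ e, x ∈ W) ∧ (∃ y ∈ e, y ∉ W ∧ y ∉ A))) ∨
          ((∀ x ∈ e, x ∈ W) ∧ ¬ e.IsDiag)) = False :=
        propext (iff_false_intro (by rintro (⟨-, h⟩ | h); exacts [hnot h, hS h]))
      have h2 : ((False ∧ ¬ (∀ x ∈ e, x ∈ W) ∧ ¬ ((∃ x ∈ e, x ∈ W) ∧ (∃ y ∈ e, y ∉ W ∧ y ∉ A))) ∨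
          ((∀ x ∈ e, x ∈ W) ∧ ¬ e.IsDiag)) = False :=
        propext (iff_false_intro (by rintro (⟨h, -⟩ | h); exacts [h, hS h]))
      simp only [h1, h2, if_neg hS, if_pos hZ, bernoulliMeasure_self_eq_dirac, bernoulliMeasure_zero]
    · have hyes : ¬ (∀ x ∈ e, x ∈ W) ∧ ¬ ((∃ x ∈ e, x ∈ W) ∧ (∃ y ∈ e, y ∉ W ∧ y ∉ A)) :=
        ⟨fun h => hZ (Or.inl h), fun h => hZ (Or.inr h)⟩
      have h1 : ((True ∧ ¬ (∀ x ∈ e, x ∈ W) ∧ ¬ ((∃ x ∈ e, x ∈ W) ∧ (∃ y ∈ e, y ∉ W ∧ y ∉ A))) ∨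
          ((∀ x ∈ e, x ∈ W) ∧ ¬ e.IsDiag)) = True := propext (iff_true_intro (Or.inl ⟨trivial, hyes⟩))
      have h2 : ((False ∧ ¬ (∀ x ∈ e, x ∈ W) ∧ ¬ ((∃ x ∈ e, x ∈ W) ∧ (∃ y ∈ e, y ∉ W ∧ y ∉ A))) ∨
          ((∀ x ∈ e, x ∈ W) ∧ ¬ e.IsDiag)) = False :=
        propext (iff_false_intro (by rintro (⟨h, -⟩ | h); exacts [h, hS h]))
      simp only [h1, h2, if_neg hS, if_neg hZ]

/-- **The pocket law (domain Markov + glue/kill push-forward).**  For every candidate pocket `W` and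
every event `E`: `μ(Pk_W ∩ Ψ_W⁻¹ E) = μ(Pk_W) · (prodBernoulli q_W)(E)`.
[folklore; Grimmett 1999 §1.3, §2.2] -/
theorem pocketLaw (w : Sym2 (Fin n) → unitInterval) (A W : Finset (Fin n)) (o : Fin n) (hoA : o ∉ A)
    (E : Set (BondConfig (Fin n))) :
    (prodBernoulli w).real
        ({ω : BondConfig (Fin n) | ∀ v : Fin n, ω ∈ openConnIn ((↑A : Set (Fin n))ᶜ) o v ↔ v ∈ W} ∩
          {ω | ({e | (e ∈ ω ∧ ¬ (∀ x ∈ e, x ∈ W) ∧ ¬ ((∃ x ∈ e, x ∈ W) ∧ (∃ y ∈ e, y ∉ W ∧ y ∉ A))) ∨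
              ((∀ x ∈ e, x ∈ W) ∧ ¬ e.IsDiag)} : BondConfig (Fin n)) ∈ E}) =
      (prodBernoulli w).real
          {ω : BondConfig (Fin n) | ∀ v : Fin n, ω ∈ openConnIn ((↑A : Set (Fin n))ᶜ) o v ↔ v ∈ W} *
        (prodBernoulli (fun e : Sym2 (Fin n) => if (∀ x ∈ e, x ∈ W) ∧ ¬ e.IsDiag then 1 else
          if (∀ x ∈ e, x ∈ W) ∨ ((∃ x ∈ e, x ∈ W) ∧ (∃ y ∈ e, y ∉ W ∧ y ∉ A)) then 0 else w e)).real E := by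
  -- independence: pocket event (pairs inside `W` and boundary pairs) vs `Ψ_W⁻¹ E` (the other pairs)
  have hΨdet : DeterminedBy
      {ω : BondConfig (Fin n) |
        ({e | (e ∈ ω ∧ ¬ (∀ x ∈ e, x ∈ W) ∧ ¬ ((∃ x ∈ e, x ∈ W) ∧ (∃ y ∈ e, y ∉ W ∧ y ∉ A))) ∨
          ((∀ x ∈ e, x ∈ W) ∧ ¬ e.IsDiag)} : BondConfig (Fin n)) ∈ E}
      (↑(Finset.univ.filter fun e : Sym2 (Fin n) =>
        (∀ x ∈ e, x ∈ W) ∨ ((∃ x ∈ e, x ∈ W) ∧ (∃ y ∈ e, y ∉ W ∧ y ∉ A))) : Set (Sym2 (Fin n)))ᶜ := by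
    rw [determinedBy_iff]
    intro ω ω' hωω'
    have key : ∀ e : Sym2 (Fin n), (¬ (∀ x ∈ e, x ∈ W) ∧
        ¬ ((∃ x ∈ e, x ∈ W) ∧ (∃ y ∈ e, y ∉ W ∧ y ∉ A))) → (e ∈ ω ↔ e ∈ ω') := by
      intro e he
      have heF : e ∈ (↑(Finset.univ.filter fun e : Sym2 (Fin n) =>
          (∀ x ∈ e, x ∈ W) ∨ ((∃ x ∈ e, x ∈ W) ∧ (∃ y ∈ e, y ∉ W ∧ y ∉ A))) : Set (Sym2 (Fin n)))ᶜ := by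
        simp only [Set.mem_compl_iff, Finset.coe_filter, Finset.mem_univ, true_and, Set.mem_setOf_eq,
          not_or]
        exact he
      exact ⟨fun h1 => (((Set.ext_iff.1 hωω') e).1 ⟨h1, heF⟩).1,
        fun h1 => (((Set.ext_iff.1 hωω') e).2 ⟨h1, heF⟩).1⟩
    have hset : ({e | (e ∈ ω ∧ ¬ (∀ x ∈ e, x ∈ W) ∧ ¬ ((∃ x ∈ e, x ∈ W) ∧ (∃ y ∈ e, y ∉ W ∧ y ∉ A))) ∨
          ((∀ x ∈ e, x ∈ W) ∧ ¬ e.IsDiag)} : BondConfig (Fin n)) =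
        {e | (e ∈ ω' ∧ ¬ (∀ x ∈ e, x ∈ W) ∧ ¬ ((∃ x ∈ e, x ∈ W) ∧ (∃ y ∈ e, y ∉ W ∧ y ∉ A))) ∨
          ((∀ x ∈ e, x ∈ W) ∧ ¬ e.IsDiag)} := by
      ext e
      simp only [Set.mem_setOf_eq]
      constructor
      · rintro (⟨h1, h2⟩ | h)
        · exact Or.inl ⟨(key e h2).1 h1, h2⟩
        · exact Or.inr h
      · rintro (⟨h1, h2⟩ | h)
        · exact Or.inl ⟨(key e h2).2 h1, h2⟩
        · exact Or.inr h
    simp only [Set.mem_setOf_eq]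
    rw [hset]
  rw [prodBernoulli_real_inter_of_determinedBy _ _ (pocket_determinedBy A W o hoA) hΨdet
    MeasurableSet.of_discrete MeasurableSet.of_discrete]
  congr 1
  -- the law of `Ψ_W`
  have hmap := sigmaLaw_prodBernoulli_map_coordwise w
    (fun e : Sym2 (Fin n) => if (∀ x ∈ e, x ∈ W) ∧ ¬ e.IsDiag then 1 else
      if (∀ x ∈ e, x ∈ W) ∨ ((∃ x ∈ e, x ∈ W) ∧ (∃ y ∈ e, y ∉ W ∧ y ∉ A)) then 0 else w e)
    (fun (e : Sym2 (Fin n)) (P : Prop) =>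
      (P ∧ ¬ (∀ x ∈ e, x ∈ W) ∧ ¬ ((∃ x ∈ e, x ∈ W) ∧ (∃ y ∈ e, y ∉ W ∧ y ∉ A))) ∨
        ((∀ x ∈ e, x ∈ W) ∧ ¬ e.IsDiag))
    (pocketLaw_map_coin w A W)
  have hmeas : Measurable fun ω : BondConfig (Fin n) =>
      ({e | (e ∈ ω ∧ ¬ (∀ x ∈ e, x ∈ W) ∧ ¬ ((∃ x ∈ e, x ∈ W) ∧ (∃ y ∈ e, y ∉ W ∧ y ∉ A))) ∨
        ((∀ x ∈ e, x ∈ W) ∧ ¬ e.IsDiag)} : BondConfig (Fin n)) := Measurable.of_discrete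
  rw [measureReal_def, measureReal_def, ← hmap, Measure.map_apply hmeas MeasurableSet.of_discrete]
  rfl

/-! ## Null pockets -/

/-- A candidate pocket not contained in a closed `A`-free region `U ∋ o` (no positive pair from `U` to
the outside of `U ∪ A`) has probability `0`: the pocket would have to leave `U` through a weight-`0`
pair. [folklore] -/
theorem pocket_null_of_not_subset (w : Sym2 (Fin n) → unitInterval) (A U W : Finset (Fin n)) (o : Fin n)
    (hoU : o ∈ U) (hclosed : ∀ x ∈ U, ∀ y : Fin n, y ∉ U → y ∉ A → w s(x, y) = 0) (hW : ¬ W ⊆ U) :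
    (prodBernoulli w).real
      {ω : BondConfig (Fin n) | ∀ v : Fin n, ω ∈ openConnIn ((↑A : Set (Fin n))ᶜ) o v ↔ v ∈ W} = 0 := by
  obtain ⟨v, hvW, hvU⟩ := Finset.not_subset.1 hW
  refine sigmaRec_null w _ (Finset.univ.filter fun e : Sym2 (Fin n) => w e = 0)
    (fun e he => (Finset.mem_filter.1 he).2) ?_
  intro ω hω
  have hp : PathIn (openGraph ω) ((↑A : Set (Fin n))ᶜ) o v :=
    Literature.Probability.Percolation.DCT16.pathIn_of_mem_openConnIn ((hω v).2 hvW)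
  obtain ⟨x, y, hx, hy, hyA, hxy, -⟩ := hp.exit (R := (↑U : Set (Fin n))) (Finset.mem_coe.2 hoU)
    (fun h => hvU (Finset.mem_coe.1 h))
  rw [openGraph_adj] at hxy
  refine ⟨s(x, y), Finset.mem_filter.2 ⟨Finset.mem_univ _, ?_⟩, hxy.1⟩
  exact hclosed x (Finset.mem_coe.1 hx) y (fun h => hy (Finset.mem_coe.2 h))
    (fun h => hyA (Finset.mem_coe.2 h))


end

end Summit.CriticalPhenomena.PercolationContinuityZ3.Theorems
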